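import Summits.QuantumFields.YangMills.Theorems.FluctuationComparisonRegPrIntLS2BetaFacePreimageLocal
import Summits.QuantumFields.YangMills.Theorems.FluctuationComparisonRegPrIntLS2BetaCombTransporter
import Summits.QuantumFields.YangMills.Theorems.FluctuationComparisonRegPrIntLS2BetaQuaternionReadDerivKStepSup
import Summits.QuantumFields.YangMills.Theorems.FluctuationComparisonRegPrIntLS2BetaThresholdSum
import Summits.QuantumFields.YangMills.Theorems.FluctuationComparisonRegPrIntLS2BetaCritMQuaternionReadWindow
import Summits.QuantumFields.YangMills.Theorems.FluctuationComparisonRegPrIntLS2BetaBackgroundLetterOfThm1Pair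
import HarnessLib

/-!
# S2β ∕ GAP♯∘ strata residue — THE CLOSING PREFIX DOOR OF THE (RINV-curl) ROAD: the letter (RINV-curl)_q of ✓`…S2BetaPreOfLetters.pre_of_letters` (`hR`, VERBATIM)
# FROM THE BACKGROUND LETTER (BKG) ALONE, via the comb transporter, the face curl count, (D2) and the threshold sum (T³ record; DEFINITION-FREE)

Cell `ym3-torus` (YM ladder rung R3 = continuum `SU(2)` Yang–Mills on the three-torus — a RUNG: NOT d = 4, NOT infinite volume,
NOT a mass gap, NOT Clay).  Width seat «width 16» `ym3-torus-px16` (gen 22), FREE px helper on crux `stmt-QuantumFields-20520`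
(`FluctuationComparisonRegPrIntL`), count-neutral, DEFINITION-FREE (0 `def`, 0 `instance`, 0 `notation`, 0 `sorry`), default heartbeats.

WHAT.  ★★★ `rinvCurl_of_bkg (G) (hBkg)` : the (RINV-curl)_q letter `hR` of ✓`…S2BetaPreOfLetters.pre_of_letters` ∕ `multAx_of_letters` — «`∃ γ₁ > 0, ∃ C_R ≥ 0, ∀ F γ … ∀ U₀ ∈ argmin,
∀ v, ∃ ζ, DMq ζ = v ∧ Σ_p ‖(curl_{U₀} ζ)_p‖ ≤ C_R·L^{K−J}·Σ_B ‖v B‖`» (text VERBATIM, `DMq` = ✓p825180's quaternion read) — from the background letter (BKG) of ✓p824141 ∕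
✓p822405 (`hBkg`, VERBATIM; any guard `G`); ★★★ `rinvCurl_of_thm1Pair (hT) (G)` : the same from the Thm-1 pair at every odd `L > 1` (✓`bkgLetter_of_thm1Pair`).
HOW (at an argmin good history `U₀`, `N = L^{K−J}`): the local closing ✓`…S2BetaFacePreimageLocal.exists_preimage_curl_local` with
* the COMB of px13 g25 ✓`…S2BetaCombTransporter`: `H_x z = holAt U₀ (walk (ι_k x) (stairWord 1 (z − ι_k x)))`, root-trivial (`holAt_comb_root`), interior cycles `δ_I`-thin with
  `δ_I = (d−1)((N−1)∕2)·θ₀` (`dist1_comb_cycle_le`), `θ₀ = C₁θ_J N⁻²` (BKG);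
* (D2) in `DMq` currency, px13 g25 ✓`…QuaternionReadDerivKStepSup.norm_qfderiv_apply_le`: `A_D = 21·exp(c₃·Σ_{i<K−J}(5L)²∕4·θ(K−i))·N ≤ 21·e^{c₃}·N` once the threshold SUM is
  `≤ 1` (✓`…S2BetaThresholdSum.thresholdSum_small`, depth-free);
* the dictionary guard and `θ_J ≤ a₁` from ✓`…S2BetaCritMQuaternionReadWindow.prefixNumerics`, with `a₁` so small that `A_D·2δ_I ≤ 42·e^{c₃}·C₁·θ_J ≤ ½`;
* the face curl count ✓`…FaceSpreadCurlCount` inside the local closing: `Σ ≤ 16(N + C₁θ_J + C₁θ_J(N−1))·Σ‖v B‖ ≤ 16(1 + 2C₁)·N·Σ‖v B‖`, so `C_R := 16(1 + 2C₁)`.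
⇒ BY KERNEL with ✓`…S2BetaPreOfLetters.multAx_of_letters`: «MULT♭-ax» ⟸ {Thm-1 pair, AVG₂♭-ax_q} — (RINV-curl)_q is DISCHARGED.

HONEST SCOPE.  Plumbing of landed doors + threshold numerics; nothing of Bałaban's renormalisation analysis beyond the cited one-step facts is asserted; AVG₂♭-ax_q, «CRIT-ax»,
(D-ax)∕(F-ax), GAP♯∘ (`stub_uniformFibreGapOrbit`; registry `Lines/semiclassical_s2beta.lean` 3732b7df UNTOUCHED), the five registered stubs, S2β, crux 20520, 19936, 19200 and
`YM3TorusSU2` are NOT proved; no registered stub is closed; the Yang–Mills mass gap is NOT proved.  Sorry-free, axioms standard.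

References: T. Bałaban, CMP **98** (1985) 17–51 [Balaban1985Averaging] ((125) p.36, Sect. D (139)–(147) pp.39–40: the right inverse of the linearised averaging, here for the
(0.4) average along the comb); CMP **102** (1985) 277–309 [Balaban1985Variational] (Thm 1 (8)–(10) p.279, (34) p.283); CMP **102** (1985) 255–275 [Balaban1985UV3]
((3) p.256, (7) p.257); CMP **109** (1987) 249–301 [Balaban1987RG1] ((0.4) p.253, (0.21)–(0.22) p.256).
-/

set_option autoImplicit false

noncomputable section

open scoped Matrix.Norms.L2Operator Topology Quaternion
open Filter Set Function Finset
open Literature.MathematicalPhysics.QuantumLattice (su2Quat)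
open Literature.MathematicalPhysics.QuantumFieldTheory.Balaban1983to89
open Literature.MathematicalPhysics.QuantumFieldTheory.Balaban1983to89.HaarExponentialChart
open Literature.MathematicalPhysics.QuantumFieldTheory.Balaban1983to89.ExpMeanLog (expMeanLogSU deltaSU deltaSU_pos)
open Literature.MathematicalPhysics.QuantumFieldTheory.Balaban1983to89.Node00 hiding blockIter
open Literature.MathematicalPhysics.QuantumFieldTheory.Balaban1983to89.T3ContinuumYM3Torus
open Literature.MathematicalPhysics.QuantumFieldTheory.Balaban1983to89.T3UnitLawDensityEML (ℰp)
open Literature.MathematicalPhysics.QuantumFieldTheory.Balaban1983to89.T3UnitScaleTilt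
open Literature.MathematicalPhysics.QuantumFieldTheory.Balaban1983to89.T3TiltDescent
open Literature.MathematicalPhysics.QuantumFieldTheory.Balaban1983to89.T3ConstrainedMinimiser (fibre)
open Literature.MathematicalPhysics.QuantumFieldTheory.Balaban1983to89.T3PrintedRegularMinimiser
open Literature.MathematicalPhysics.QuantumFieldTheory.Balaban1983to89.T3PrintedMinimiserExistence
open Literature.MathematicalPhysics.QuantumFieldTheory.Balaban1983to89.T3Thm1UniquenessSchema (Thm1UniqueMinOrbitAt)
open Literature.MathematicalPhysics.QuantumFieldTheory.Balaban1983to89.T3MinimiserStabilityReduction (θBal_pos)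
open Literature.MathematicalPhysics.QuantumFieldTheory.Balaban1983to89.T4HaarSU2ExpChart (expPoint)
open Literature.MathematicalPhysics.QuantumFieldTheory.Balaban1983to89.T4ExpWindowSmallField (imVec)
open Literature.MathematicalPhysics.QuantumFieldTheory.Balaban1983to89.B15Prop1ChartSU2 (adSU2)
open Literature.MathematicalPhysics.QuantumFieldTheory.Balaban1983to89.B14.Eq22Determines (blockIter)
open Literature.MathematicalPhysics.QuantumFieldTheory.Balaban1983to89.B15DeterminingSets (embIter)
open Literature.MathematicalPhysics.QuantumFieldTheory.Balaban1983to89.T4Continuum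
open Summit.QuantumFields.YangMills.Theorems.FluctuationComparisonRegPrIntLS2BetaFacePreimageLocal (exists_preimage_curl_local)
open Summit.QuantumFields.YangMills.Theorems.FluctuationComparisonRegPrIntLS2BetaCombTransporter (dist1_comb_cycle_le holAt_comb_root)
open Summit.QuantumFields.YangMills.Theorems.FluctuationComparisonRegPrIntLS2BetaQuaternionReadDerivKStepSup (norm_qfderiv_apply_le)
open Summit.QuantumFields.YangMills.Theorems.FluctuationComparisonRegPrIntLS2BetaThresholdSum (thresholdSum_small)
open Summit.QuantumFields.YangMills.Theorems.FluctuationComparisonRegPrIntLS2BetaCritMQuaternionReadWindow (prefixNumerics)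
open Summit.QuantumFields.YangMills.Theorems.FluctuationComparisonRegPrIntLS2BetaBackgroundLetterOfThm1Pair (bkgLetter_of_thm1Pair)

namespace Summit.QuantumFields.YangMills.Theorems.FluctuationComparisonRegPrIntLS2BetaRinvCurlOfComb

/-! ## §1 Arithmetic of the constants at one argmin -/

/-- The interior thinness in block units: `((d−1)·((N−1)∕2) : ℕ)·θ₀ ≤ N·θ₀` at `d = 3`, `θ₀ ≥ 0`. [folklore] -/
theorem deltaI_le (N : ℕ) {θ₀ : ℝ} (hθ₀ : 0 ≤ θ₀) : (((3 - 1) * ((N - 1) / 2) : ℕ) : ℝ) * θ₀ ≤ (N : ℝ) * θ₀ := by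
  refine mul_le_mul_of_nonneg_right ?_ hθ₀
  have h : (3 - 1) * ((N - 1) / 2) ≤ N := by omega
  exact_mod_cast h

/-- The final constant: `2·(4·(3−1)·(N + (θ₀ + δ_I)·N²)) ≤ 16(1 + 2C₁)·N` when `θ₀ = C₁θ∕N²`, `δ_I ≤ Nθ₀`, `0 ≤ θ ≤ 1`, `C₁ ≥ 0`, `N ≥ 1`. [folklore] -/
theorem final_constant_le {N θ C₁ δI : ℝ} (hN : 1 ≤ N) (hθ1 : θ ≤ 1) (hC₁ : 0 ≤ C₁)
    (hδI : δI ≤ N * (C₁ * θ * (N ^ 2)⁻¹)) :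
    2 * (4 * ((3 : ℝ) - 1) * (N ^ (3 - 2) + (C₁ * θ * (N ^ 2)⁻¹ + δI) * N ^ (3 - 1))) ≤ 16 * (1 + 2 * C₁) * N := by
  have hN0 : 0 < N := by linarith
  have hN2 : 0 < N ^ 2 := by positivity
  have h1 : C₁ * θ * (N ^ 2)⁻¹ * N ^ 2 = C₁ * θ := by field_simp
  have h2 : δI * N ^ 2 ≤ N * (C₁ * θ) := by
    calc δI * N ^ 2 ≤ N * (C₁ * θ * (N ^ 2)⁻¹) * N ^ 2 := mul_le_mul_of_nonneg_right hδI hN2.le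
      _ = N * (C₁ * θ) := by field_simp
  have h3 : C₁ * θ ≤ C₁ := by nlinarith
  have h4 : C₁ ≤ C₁ * N := le_mul_of_one_le_right hC₁ hN
  have h5 : N * (C₁ * θ) ≤ N * C₁ := mul_le_mul_of_nonneg_left h3 hN0.le
  have e1 : N ^ (3 - 2) = N := by norm_num
  have e2 : N ^ (3 - 1) = N ^ 2 := by norm_num
  have expand : 2 * (4 * ((3 : ℝ) - 1) * (N + (C₁ * θ * (N ^ 2)⁻¹ + δI) * N ^ 2)) =
      16 * N + 16 * (C₁ * θ * (N ^ 2)⁻¹ * N ^ 2) + 16 * (δI * N ^ 2) := by ring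
  rw [e1, e2, expand, h1]
  linarith

/-! ## §2 The closing -/

set_option maxHeartbeats 400000 in
/-- ★★★ **(RINV-curl)_q FROM (BKG)**: the letter `hR` of ✓`…S2BetaPreOfLetters.pre_of_letters` VERBATIM (any guard `G`), from the background letter `hBkg` of
✓`…S2BetaMultOfPreimages.multAx_of_preimages` VERBATIM — comb transporter (px13 g25), face curl count, (D2) for `DMq` (px13 g25), threshold sum, and the local closing.
`C_R := 16·(1 + 2C₁)`. [cite: Balaban1985Averaging, (125) p.36, Sect. D (139)-(147) pp.39-40; Balaban1985Variational, Thm 1 (8)-(10) p.279, (34) p.283; Balaban1985UV3, (7) p.257; Balaban1987RG1, (0.4) p.253] -/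
theorem rinvCurl_of_bkg
    (G : (F : T3Family) → (J : ℕ) → GaugeField (F.P J) 0 (Matrix.specialUnitaryGroup (Fin 2) ℂ) → Prop)
    (hBkg : ∀ (L : ℕ), ∃ c₀ : ℝ, 0 < c₀ ∧ c₀ ≤ 1 ∧ ∀ (cw : ℝ), 0 < cw → cw ≤ c₀ → ∃ pS : ℝ, ∀ (b₀ p₀ : ℝ), 0 < b₀ → pS ≤ p₀ → 0 < p₀ → ∃ ε₁ : ℝ, 0 < ε₁ ∧ ∀ (ε₀ : ℝ), 0 < ε₀ → ε₀ ≤ ε₁ →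
    ∃ γ₁ : ℝ, 0 < γ₁ ∧ ∃ C₁ : ℝ, 0 ≤ C₁ ∧ ∀ (F : T3Family) (γ : ℝ), F.L = L → 0 < γ → γ ≤ γ₁ →
      ∀ (J K : ℕ) (hJK : J ≤ K) (V : GaugeField (F.P J) 0 (Matrix.specialUnitaryGroup (Fin 2) ℂ)), PlaqSmall (θBal F.L γ (cw * b₀) p₀ J) V →
        G F J V →
        ∀ U₀ ∈ {U' : GaugeField (F.P K) 0 (Matrix.specialUnitaryGroup (Fin 2) ℂ) | U' ∈ fibre F ℰp J K hJK V ∧ U' ∈ histGood F ℰp (θBal F.L γ b₀ p₀) K J ∧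
            wilsonAction4 U' = minActionRegPr F J K hJK ε₀ V},
        ∀ p : Plaq (F.P K) 0, dist1 (GaugeField.plaqHol U₀ p) ≤ C₁ * θBal F.L γ b₀ p₀ J * ((F.L : ℝ)⁻¹) ^ (2 * (K - J))) :
    ∀ (L : ℕ), ∃ c₀ : ℝ, 0 < c₀ ∧ c₀ ≤ 1 ∧ ∀ (cw : ℝ), 0 < cw → cw ≤ c₀ → ∃ pS : ℝ, ∀ (b₀ p₀ : ℝ), 0 < b₀ → pS ≤ p₀ → 0 < p₀ → ∃ ε₁ : ℝ, 0 < ε₁ ∧ ∀ (ε₀ : ℝ), 0 < ε₀ → ε₀ ≤ ε₁ →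
    ∃ γ₁ : ℝ, 0 < γ₁ ∧ ∃ C_R : ℝ, 0 ≤ C_R ∧ ∀ (F : T3Family) (γ : ℝ), F.L = L → 0 < γ → γ ≤ γ₁ →
      ∀ (J K : ℕ) (hJK : J ≤ K) (V : GaugeField (F.P J) 0 (Matrix.specialUnitaryGroup (Fin 2) ℂ)), PlaqSmall (θBal F.L γ (cw * b₀) p₀ J) V →
        G F J V →
        ∀ U₀ ∈ {U' : GaugeField (F.P K) 0 (Matrix.specialUnitaryGroup (Fin 2) ℂ) | U' ∈ fibre F ℰp J K hJK V ∧ U' ∈ histGood F ℰp (θBal F.L γ b₀ p₀) K J ∧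
            wilsonAction4 U' = minActionRegPr F J K hJK ε₀ V},
        ∀ v : PBond (F.P J) 0 → EuclideanSpace ℝ (Fin 3), ∃ ζ : PBond (F.P K) 0 → EuclideanSpace ℝ (Fin 3), (fderiv ℝ (fun (ζ : PBond (F.P K) 0 → EuclideanSpace ℝ (Fin 3)) (B : PBond (F.P J) 0) =>
            imVec (su2Quat (descendTo F ℰp J K hJK (fun ℓ => expPoint (ζ ℓ) * U₀ ℓ) B * (descendTo F ℰp J K hJK U₀ B)⁻¹))) 0) ζ = v ∧
            ∑ p : Plaq (F.P K) 0, ‖adSU2 (GaugeField.plaqHol U₀ p)⁻¹ (ζ ⟨p.src, p.μ⟩) + adSU2 ((GaugeField.plaqHol U₀ p)⁻¹ * U₀ ⟨p.src, p.μ⟩) (ζ ⟨p.src.shift p.μ, p.ν⟩) -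
                  adSU2 ((GaugeField.plaqHol U₀ p)⁻¹ * U₀ ⟨p.src, p.μ⟩ * U₀ ⟨p.src.shift p.μ, p.ν⟩ * (U₀ ⟨p.src.shift p.ν, p.μ⟩)⁻¹) (ζ ⟨p.src.shift p.ν, p.μ⟩) -
                  ζ ⟨p.src, p.ν⟩‖ ≤
              C_R * (F.L : ℝ) ^ (K - J) * ∑ B : PBond (F.P J) 0, ‖v B‖ := by
  intro L
  obtain ⟨c₀, hc₀, hc₀1, HB⟩ := hBkg L
  refine ⟨c₀, hc₀, hc₀1, fun cw hcw hcwle => ?_⟩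
  obtain ⟨pS, HB⟩ := HB cw hcw hcwle
  refine ⟨pS, fun b₀ p₀ hb hpS hp => ?_⟩
  obtain ⟨ε₁, hε₁, HB⟩ := HB b₀ p₀ hb hpS hp
  refine ⟨ε₁, hε₁, fun ε₀ hε₀ hε₀le => ?_⟩
  obtain ⟨γB, hγB, C₁, hC₁, HB⟩ := HB ε₀ hε₀ hε₀le
  by_cases hL : 1 < L
  swap
  · -- no family has this block size: everything below `∀ F, F.L = L → …` is vacuous
    refine ⟨1, one_pos, 0, le_rfl, fun F γ hFL => ?_⟩
    exact absurd (hFL ▸ F.hL.2) hL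
  -- the constants: `c₃`, `A₀ = 21·e^{c₃}`, the smallness target `a₁` for `θ_J`, the threshold-sum bound `1`
  set c₃ : ℝ := ((3 + 2 : ℕ) : ℝ) * (422 + 1616 * ((3 + 2 : ℕ) : ℝ)) with hc₃
  set A₀ : ℝ := (1 + 4 * ((3 + 2 : ℕ) : ℝ)) * Real.exp c₃ with hA₀
  have hA₀pos : 0 < A₀ := by positivity
  set a₁ : ℝ := min 1 (1 / (4 * A₀ * (C₁ + 1))) with ha₁
  have ha₁pos : 0 < a₁ := lt_min one_pos (by positivity)
  obtain ⟨γN, hγN, α, HN⟩ := prefixNumerics (L := L) hL (a₁ := a₁) (B₃ := 1) (ε₀ := 1) ha₁pos one_pos one_pos hb p₀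
  set q : ℝ := (((5 * L : ℕ) : ℝ) ^ 2 / 4) with hq
  have hq0 : 0 ≤ q := by positivity
  obtain ⟨γS, hγS, HS⟩ := thresholdSum_small L hL b₀ p₀ hb hp q 1 1 hq0 one_pos one_pos
  refine ⟨min γB (min γN γS), lt_min hγB (lt_min hγN hγS), 16 * (1 + 2 * C₁), by positivity, ?_⟩
  intro F γ hFL hγ hγle J K hJK V hV hG U₀ hU₀ v
  have hγB' : γ ≤ γB := hγle.trans (min_le_left _ _)
  have hγN' : γ ≤ γN := hγle.trans ((min_le_right _ _).trans (min_le_left _ _))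
  have hγS' : γ ≤ γS := hγle.trans ((min_le_right _ _).trans (min_le_right _ _))
  obtain ⟨hθpos, hθa₁, -, -, hθα, hα24, hαδ, hαL⟩ := HN F γ hFL hγ hγN'
  obtain ⟨-, hsum⟩ := HS γ hγ hγS'
  have hθ0 : ∀ i, 0 ≤ θBal F.L γ b₀ p₀ i := fun i => (hθpos i).le
  have hθα' : ∀ i, J < i → i ≤ K → (((5 * F.L : ℕ) : ℝ) ^ 2 / 4) * θBal F.L γ b₀ p₀ i ≤ α := fun i _ _ => hθα i
  have hUg : U₀ ∈ histGood F ℰp (θBal F.L γ b₀ p₀) K J := hU₀.2.1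
  -- (BKG): `θ₀ = C₁·θ_J·N⁻²`
  have hplaq := HB F γ hFL hγ hγB' J K hJK V hV hG U₀ hU₀
  set θJ : ℝ := θBal F.L γ b₀ p₀ J with hθJ
  set N : ℝ := ((F.P K).L : ℝ) ^ (K - J) with hN
  have hPL : (F.P K).L = F.L := rfl
  have hPd : (F.P K).d = 3 := rfl
  have hN1 : 1 ≤ N := by
    rw [hN, hPL]; exact one_le_pow₀ (by exact_mod_cast F.hL.2.le)
  have hN0 : 0 < N := by linarith
  set θ₀ : ℝ := C₁ * θJ * (N ^ 2)⁻¹ with hθ₀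
  have hθJ0 : 0 ≤ θJ := hθ0 J
  have hθJ1 : θJ ≤ 1 := (hθa₁ J).trans (min_le_left _ _)
  have hθ₀nn : 0 ≤ θ₀ := by positivity
  have hpow : ((F.L : ℝ)⁻¹) ^ (2 * (K - J)) = (N ^ 2)⁻¹ := by
    rw [hN, inv_pow, mul_comm 2 (K - J), pow_mul]; rfl
  have hU : ∀ p : Plaq (F.P K) 0, dist1 (GaugeField.plaqHol U₀ p) ≤ θ₀ := by
    intro p
    refine (hplaq p).trans (le_of_eq ?_)
    rw [hθ₀, hθJ, hpow]
  -- the comb (px13 g25) and its thin interior cycles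
  have hk : K - J ≤ (F.P K).m + (F.P K).K := by show K - J ≤ F.m + K; omega
  set δI : ℝ := ((((F.P K).d - 1) * (((F.P K).L ^ (K - J) - 1) / 2) : ℕ) : ℝ) * θ₀ with hδI
  have hδI0 : 0 ≤ δI := by positivity
  have hδIle : δI ≤ N * θ₀ := by
    rw [hδI, hN, hPd]; push_cast [Nat.cast_pow]
    have := deltaI_le ((F.P K).L ^ (K - J)) hθ₀nn
    push_cast at this
    exact this
  -- (D2) for `DMq`, with the threshold sum `≤ 1`
  have hsum1 : ∑ i ∈ Finset.range (K - J), (((5 * F.L : ℕ) : ℝ) ^ 2 / 4) * θBal F.L γ b₀ p₀ (K - i) ≤ 1 := by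
    have h := hsum J K hJK
    rw [← Finset.mul_sum]
    rw [hFL]; exact (by simpa only [hq, one_mul] using h)
  set AD : ℝ := A₀ * N with hAD
  have hADnn : 0 ≤ AD := by positivity
  have hD2 : ∀ (ζ : PBond (F.P K) 0 → EuclideanSpace ℝ (Fin 3)) (B : PBond (F.P J) 0),
      ‖fderiv ℝ (fun (ζ : PBond (F.P K) 0 → EuclideanSpace ℝ (Fin 3)) (B : PBond (F.P J) 0) =>
          imVec (su2Quat (descendTo F ℰp J K hJK (fun ℓ => expPoint (ζ ℓ) * U₀ ℓ) B * (descendTo F ℰp J K hJK U₀ B)⁻¹))) 0 ζ B‖ ≤ AD * ‖ζ‖ := by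
    intro ζ B
    refine (norm_qfderiv_apply_le (F := F) hJK hθ0 hθα' hα24 hαδ hαL hUg ζ B).trans ?_
    rw [hAD, hA₀, hN, hPd]
    have hexp : Real.exp ((((3 + 2 : ℕ) : ℝ)) * (422 + 1616 * ((3 + 2 : ℕ) : ℝ)) *
        ∑ i ∈ Finset.range (K - J), (((5 * F.L : ℕ) : ℝ) ^ 2 / 4) * θBal F.L γ b₀ p₀ (K - i)) ≤ Real.exp c₃ := by
      refine Real.exp_le_exp.2 ?_
      rw [hc₃]
      have hc : (0 : ℝ) ≤ ((3 + 2 : ℕ) : ℝ) * (422 + 1616 * ((3 + 2 : ℕ) : ℝ)) := by positivity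
      calc _ ≤ ((3 + 2 : ℕ) : ℝ) * (422 + 1616 * ((3 + 2 : ℕ) : ℝ)) * 1 := mul_le_mul_of_nonneg_left hsum1 hc
        _ = _ := mul_one _
    have hζ := norm_nonneg ζ
    have h21 : (0 : ℝ) ≤ 1 + 4 * ((3 + 2 : ℕ) : ℝ) := by positivity
    have hLp : (0 : ℝ) ≤ ((F.P K).L : ℝ) ^ (K - J) := by positivity
    gcongr
  -- smallness: `A_D·2δ_I ≤ 2A₀C₁θ_J ≤ ½`
  have hsmall : AD * (2 * δI) ≤ 1 / 2 := by
    have h1 : AD * (2 * δI) ≤ 2 * A₀ * C₁ * θJ := by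
      calc AD * (2 * δI) ≤ A₀ * N * (2 * (N * θ₀)) := by
            rw [hAD]; exact mul_le_mul_of_nonneg_left (by linarith) (by positivity)
        _ = 2 * A₀ * C₁ * θJ * (N * N * (N ^ 2)⁻¹) := by rw [hθ₀]; ring
        _ = 2 * A₀ * C₁ * θJ := by field_simp
    have h2 : θJ ≤ 1 / (4 * A₀ * (C₁ + 1)) := (hθa₁ J).trans (min_le_right _ _)
    have h3 : 2 * A₀ * C₁ * θJ ≤ 2 * A₀ * (C₁ + 1) * (1 / (4 * A₀ * (C₁ + 1))) := by
      have : 2 * A₀ * C₁ * θJ ≤ 2 * A₀ * (C₁ + 1) * θJ := by nlinarith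
      exact this.trans (mul_le_mul_of_nonneg_left h2 (by positivity))
    have h4 : 2 * A₀ * (C₁ + 1) * (1 / (4 * A₀ * (C₁ + 1))) = 1 / 2 := by field_simp; ring
    linarith
  -- the local closing
  obtain ⟨ζ, hζ, hcurl⟩ := exists_preimage_curl_local (F := F) hJK hθ0 hθα' hα24 hαδ hαL hUg hθ₀nn hδI0 hADnn hU
    (fun x z => holAt U₀ (walk (embIter (K - J) x) (T4Continuum.stairWord 1 (fun a => ((z a).val : ℤ) - (((embIter (K - J) x) a).val : ℤ)))))
    (fun x => holAt_comb_root U₀ x 1)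
    (fun x z κ hz hz' => dist1_comb_cycle_le hk U₀ hθ₀nn hU 1 x hz hz') hD2 hsmall v
  refine ⟨ζ, hζ, hcurl.trans ?_⟩
  refine mul_le_mul_of_nonneg_right ?_ (Finset.sum_nonneg fun B _ => norm_nonneg _)
  rw [hPd, hPL]
  rw [hN, hPL] at hN1 hδIle
  have hfin := final_constant_le (N := (F.L : ℝ) ^ (K - J)) (θ := θJ) (C₁ := C₁) (δI := δI) hN1 hθJ1 hC₁
    (by rw [hθ₀, hN, hPL] at hδIle; exact hδIle)
  have hθ₀' : θ₀ = C₁ * θJ * (((F.L : ℝ) ^ (K - J)) ^ 2)⁻¹ := by rw [hθ₀, hN, hPL]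
  rw [hθ₀']
  push_cast
  exact hfin

/-- ★★★ **(RINV-curl)_q FROM THE THM-1 PAIR AT EVERY ODD `L > 1`** (✓`bkgLetter_of_thm1Pair`). [cite: Balaban1985Variational, Thm 1 (8)-(10) p.279, (34) p.283; Balaban1985Averaging, Sect. D pp.39-40] -/
theorem rinvCurl_of_thm1Pair
    (hT : ∀ L : ℕ, Odd L → 1 < L → ∃ a₀ a₁ B₃ : ℝ, 0 < a₀ ∧ 0 < a₁ ∧ 0 < B₃ ∧ Thm1GlobalMinAt L a₀ a₁ B₃ ∧ Thm1UniqueMinOrbitAt L a₀ a₁ B₃)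
    (G : (F : T3Family) → (J : ℕ) → GaugeField (F.P J) 0 (Matrix.specialUnitaryGroup (Fin 2) ℂ) → Prop) :
    ∀ (L : ℕ), ∃ c₀ : ℝ, 0 < c₀ ∧ c₀ ≤ 1 ∧ ∀ (cw : ℝ), 0 < cw → cw ≤ c₀ → ∃ pS : ℝ, ∀ (b₀ p₀ : ℝ), 0 < b₀ → pS ≤ p₀ → 0 < p₀ → ∃ ε₁ : ℝ, 0 < ε₁ ∧ ∀ (ε₀ : ℝ), 0 < ε₀ → ε₀ ≤ ε₁ →
    ∃ γ₁ : ℝ, 0 < γ₁ ∧ ∃ C_R : ℝ, 0 ≤ C_R ∧ ∀ (F : T3Family) (γ : ℝ), F.L = L → 0 < γ → γ ≤ γ₁ →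
      ∀ (J K : ℕ) (hJK : J ≤ K) (V : GaugeField (F.P J) 0 (Matrix.specialUnitaryGroup (Fin 2) ℂ)), PlaqSmall (θBal F.L γ (cw * b₀) p₀ J) V →
        G F J V →
        ∀ U₀ ∈ {U' : GaugeField (F.P K) 0 (Matrix.specialUnitaryGroup (Fin 2) ℂ) | U' ∈ fibre F ℰp J K hJK V ∧ U' ∈ histGood F ℰp (θBal F.L γ b₀ p₀) K J ∧
            wilsonAction4 U' = minActionRegPr F J K hJK ε₀ V},
        ∀ v : PBond (F.P J) 0 → EuclideanSpace ℝ (Fin 3), ∃ ζ : PBond (F.P K) 0 → EuclideanSpace ℝ (Fin 3), (fderiv ℝ (fun (ζ : PBond (F.P K) 0 → EuclideanSpace ℝ (Fin 3)) (B : PBond (F.P J) 0) =>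
            imVec (su2Quat (descendTo F ℰp J K hJK (fun ℓ => expPoint (ζ ℓ) * U₀ ℓ) B * (descendTo F ℰp J K hJK U₀ B)⁻¹))) 0) ζ = v ∧
            ∑ p : Plaq (F.P K) 0, ‖adSU2 (GaugeField.plaqHol U₀ p)⁻¹ (ζ ⟨p.src, p.μ⟩) + adSU2 ((GaugeField.plaqHol U₀ p)⁻¹ * U₀ ⟨p.src, p.μ⟩) (ζ ⟨p.src.shift p.μ, p.ν⟩) -
                  adSU2 ((GaugeField.plaqHol U₀ p)⁻¹ * U₀ ⟨p.src, p.μ⟩ * U₀ ⟨p.src.shift p.μ, p.ν⟩ * (U₀ ⟨p.src.shift p.ν, p.μ⟩)⁻¹) (ζ ⟨p.src.shift p.ν, p.μ⟩) -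
                  ζ ⟨p.src, p.ν⟩‖ ≤
              C_R * (F.L : ℝ) ^ (K - J) * ∑ B : PBond (F.P J) 0, ‖v B‖ :=
  rinvCurl_of_bkg G (bkgLetter_of_thm1Pair hT G)

end Summit.QuantumFields.YangMills.Theorems.FluctuationComparisonRegPrIntLS2BetaRinvCurlOfComb

end
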